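import Summits.BirchSwinnertonDyer.BirchSwinnertonDyer.Theorems.ClassRecordThreeEulerHalvesAtThreeWalkSupplyAtThreeDisplayPrint
import Summits.BirchSwinnertonDyer.BirchSwinnertonDyer.Theorems.ClassRecordThreeEulerHalvesAtThreeJetchevMaxOfSwapSharp
import Summits.BirchSwinnertonDyer.BirchSwinnertonDyer.Theorems.Rank1ResidualJetSwapLevelRaisingLiterature
import Summits.BirchSwinnertonDyer.Rank1Residual.JET.McCallumProp44ByName
import HarnessLib

/-!
# `stub_jetchevMaxHLAtThree` (Jetchev 2008 Thm. 1.4, MAX form, at `3 ∥ N`; the registered Euler-system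
# input of item 19109 `EulerHalvesAtThree`) MODULO FIVE NAMED LITERATURE FACTS — McCallum 1991 Prop. 5.2
# (`h52`) STRUCK from the display of record: Kolyvagin's redefinition of `m_∞` is now the KERNEL prime
# swap (cell `bsd-stepL`, seat `bsd-stepL-tam3-p1` g10; helper toward item 19109)

HONEST FRAMING. Nothing here proves BSD, J₃ or the divisibility of any Heegner point of any curve; the
registered stub `stub_jetchevMaxHLAtThree` is proved MODULO five NAMED PRINT hypotheses — a CONDITIONAL
result (D-0014), not a discharge; no item closes; 0 classes move (T7);
`--supports stmt-BirchSwinnertonDyer-19109` (helper).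

WHAT THIS FILE DOES. The display of record `Koly.jetchevMaxHLAtThree_of_facts_of_print` (p547155, this
seat g8) reads the stub ⟸ SIX cite-only named facts {`h52` McCallum Prop. 5.2, `h44` McCallum Prop. 4.4,
`hGZ` Gross–Zagier, `hmod` modularity, `hPT` Poitou–Tate for Selmer structures, `hF1` Gross 1991 §6 ∕
[GZ86 III (3.1)]}; `h52` enters only as Kolyvagin's redefinition of `m_∞` (the `hK` input of the §6
bridge). Meanwhile (2026-08-27) cell `bsd-jet` (seat pv-2 g6) landed Kolyvagin's PRIME SWAP in the
kernel — `JET.Swap.levelRaising_of_literature hPT hF1 h372 : ‹level raising at minimal depth›`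
(`Theorems/Rank1ResidualJetSwapLevelRaisingLiterature.lean`; McCallum's proof of Prop. 5.2, case
`C = {0}`, pp. 305–306, run at level `p` on the root classes) from THREE named statements, the third being
the image-free Gross 1991 Prop. 3.7 (2) `GrossLMS1991.prop37_2_frobeniusCongruence` (`h372`), from which
`h44` itself follows (`JET.prop44_of_frobeniusCongruence`, bsd-jet ty g10); and cell bsd-stepL's
corner-p1 (g8) displayed this stub ⟸ {hswap, hlev} with NO finiteness ∕ Prop. 5.2 input
(`Koly.jetchevMaxHLAtThree_of_swap_of_perLevel'`, `…JetchevMaxOfSwapSharp`). This file composes the three: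
* `hlevAtThree_of_prop44_of_poitouTate_of_Gross1991` — the per-level inequality `hlev` at the stub's
  frames (the Jetchev §6 WALK: Prop. 6.4 ∘ Thm. 6.3 on the row objects), stated STANDALONE; its proof is
  p547155's walk block byte for byte (inputs `h44`, `hGZ`, `hmod`, `hPT`, `hF1`);
* `jetchevMaxHLAtThree_of_swapLiterature : h372 → hGZ → hmod → hPT → hF1 → ‹stub VERBATIM›` —
  corner-p1's `…_of_swap_of_perLevel'` with hswap := bsd-jet's `Swap.levelRaising_of_literature hPT hF1 h372`
  transported to the frame (`¬CM` ⟸ multiplicative at `3`; `d_K ∉ {−3, −4}` ⟸ Heegner ∧ `3 ∣ N` ∧ `d_K` odd;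
  the `3`-adic tower ⟸ `Surj W 3` ∧ multiplicative at `3`; `1 + M` ↔ `M + 1`; the target index `e ≤ max e (1+M)`)
  — the transport is corner-p1 g11's (`cornerUpper3_jetchevMax_of_namedFacts`, the 19111 twin) — and
  hlev := the first theorem at `h44 := JET.prop44_of_frobeniusCongruence h372`.
WHAT IS LEFT on the stub (all cite-only named facts of `Literature/`, each an `X : Prop` with a locator):
`GrossLMS1991.prop37_2_frobeniusCongruence` (Gross 1991 Prop. 3.7 (2), image-free = Nekovář 2007
Prop. 4.13 (ii)), `gross_zagier` ([GZ86] I (6.3)), `hasEntireLFunction_rat` (modularity),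
`poitouTate_selmerStructure_duality_conj` (Milne ADT I 4.10 ∕ Howard 2.1.11),
`Gross1991_heegnerPoint_sub_ratTorsion_mem_E0` (Gross 1991 §6 ∕ [GZ86 III (3.1)]). McCallum 1991 is cited
for NOTHING any more on this stub (Prop. 4.4 ⟸ `h372`; Prop. 5.2 = kernel; Cor. 5.6 upper half = this
seat g9's `…KolyvaginShaOrderDivisibleEnd`). References (locators only; no cited FACT is declared):
[cite: Jetchev2008, Thm. 1.4 (p. 812), Lemma 5.1, Prop. 5.3, Proof of Thm. 1.1 (pp. 820–824)]
[cite: McCallumLMS1991, §4 Prop. 4.4, §5 Lemma 5.1, Prop. 5.2 and proof (pp. 303–306)]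
[cite: GrossLMS1991, Prop. 3.7 (2), §5 Prop. 5.3, §6 Prop. 6.2 (1)] [cite: GrossZagier1986, I (6.3), III (3.1)]
[cite: MilneADT2006, Ch. I, Thm. 4.10(b)] [cite: Nekovar2007, Prop. 4.13 (ii)]. Design: two theorems, no
definitions; `K : Type`. Axioms: `propext`, `Classical.choice`, `Quot.sound`.
-/

set_option autoImplicit false

noncomputable section

open scoped Classical NumberField

namespace Summit.BirchSwinnertonDyer.Rank1Residual.X11b.Three.Koly

open WeierstrassCurve IsDedekindDomain NumberField Field Literature.NumberTheory.EllipticCurves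
  Literature.NumberTheory.EllipticCurves.ModularForms Literature.NumberTheory.EllipticCurves.Jetchev2008
  Literature.NumberTheory.EllipticCurves.KolyvaginCocycle
  Literature.NumberTheory.EllipticCurves.Rank1Residual Literature.NumberTheory.GaloisRepresentations
  Literature.NumberTheory.GaloisRepresentations.DiscreteGaloisModule
  Literature.NumberTheory.GaloisCohomology Literature.NumberTheory.Automorphic
  Summit.BirchSwinnertonDyer.Rank1Residual.X11b Summit.BirchSwinnertonDyer.Rank1Residual.JET

/-- **The per-level inequality `hlev` at the frames of `stub_jetchevMaxHLAtThree`** (Jetchev 2008 §6: the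
WALK Prop. 6.4 ∘ Thm. 6.3 on the row objects at level `3^k`: «`m(n) < k`, `ord₃ c_v ≤ k`, `k + m(n) ≤ M(n)`
⟹ `ord₃ c_v ≤ m(n)`» for every admissible `(n, d)`), STANDALONE, modulo the four named Literature facts
{McCallum Prop. 4.4, Gross–Zagier, modularity, Poitou–Tate for Selmer structures, Gross 1991 §6 ∕
[GZ86 III (3.1)]} — the walk block of `jetchevMaxHLAtThree_of_facts_of_print` (p547155) byte for byte.
CONDITIONAL; nothing asserted about any curve.
[cite: Jetchev2008, Lemma 5.1, Prop. 5.3, Thm. 5.2, Proof of Thm. 1.1 (pp. 820–824)]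
[cite: McCallumLMS1991, §4 Prop. 4.4] [cite: GrossLMS1991, §5 Prop. 5.3, §6 Prop. 6.2 (1)]
[cite: GrossZagier1986, III (3.1)] [cite: MilneADT2006, Ch. I, Thm. 4.10(b)] -/
theorem hlevAtThree_of_prop44_of_poitouTate_of_Gross1991
    (h44 : McCallum1991.prop44_localOrder_kolyvaginClass_mul_eq)
    (hGZ : ∀ (N : ℕ) [NeZero N] (W : WeierstrassCurve ℚ) (K : Type) [Field K] [NumberField K],
      gross_zagier N W K)
    (hmod : hasEntireLFunction_rat)
    (hPT : ∀ (K : Type) [Field K] [NumberField K], poitouTate_selmerStructure_duality_conj K)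
    (hF1 : Gross1991_heegnerPoint_sub_ratTorsion_mem_E0) :
    ∀ (W : WeierstrassCurve ℚ) [W.IsElliptic] [W.IsGloballyMinimal] [NeZero (W.conductorNorm ℤ)]
      (K : Type) [Field K] [NumberField K]
      (Dt : ModularParametrizationData W (W.conductorNorm ℤ)) (β : ℤ) (ι : K →+* ℂ),
      W.analyticRank = 1 → W.HasMultiplicativeReductionAtPrime 3 → Surj W 3 →
      IsImaginaryQuadratic K → SatisfiesHeegnerHypothesis (W.conductorNorm ℤ) K →
      Odd (NumberField.discr K) → (W.quadraticTwist (NumberField.discr K : ℚ)).entireLFunction 1 ≠ 0 →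
      (4 * (W.conductorNorm ℤ : ℤ)) ∣ β ^ 2 - NumberField.discr K → ¬ (3 : ℤ) ∣ Dt.c →
      ∀ (v : HeightOneSpectrum (𝓞 ℚ)) (k n : ℕ) (d : KolyvaginHeegnerData Dt β ι n), Squarefree n →
        (∀ ℓ ∈ n.primeFactors, Zhang2014.IsKolyvaginPrime (W.conductorNorm ℤ) W K 3 ℓ) →
        (if divOrd d 3 < Zhang2014.levelIndex W 3 n then divOrd d 3 else (⊤ : ℕ∞)) < (k : ℕ∞) →
        padicValNat 3 (W.tamagawaNumberAt v) ≤ k →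
        (k : ℕ∞) + (if divOrd d 3 < Zhang2014.levelIndex W 3 n then divOrd d 3 else ⊤) ≤
          Zhang2014.levelIndex W 3 n →
        (padicValNat 3 (W.tamagawaNumberAt v) : ℕ∞) ≤
          (if divOrd d 3 < Zhang2014.levelIndex W 3 n then divOrd d 3 else ⊤) := by
  intro W _ _ _ K _ _ Dt β ι hr hmult hρ hK hHN hodd hLt hβ hc3 v k n d hsq hkol h1 h2 h3
  -- `k ≥ 1` and the admissibility of `n` at level `k`
  have hk : 1 ≤ k := by
    rcases Nat.eq_zero_or_pos k with rfl | hk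
    · exact absurd h1 (by simp)
    · exact hk
  have hkM : (k : ℕ∞) ≤ Zhang2014.levelIndex W 3 n := le_trans le_self_add h3
  have hn : Squarefree n ∧ ∀ q ∈ n.primeFactors,
      Zhang2014.IsKolyvaginPrime (W.conductorNorm ℤ) W K 3 q ∧ k ≤ Zhang2014.kolyvaginIndex W 3 q :=
    ⟨hsq, fun q hq ↦ ⟨hkol q hq, Zhang2014.natCast_le_levelIndex_iff.mp hkM q hq⟩⟩
  -- frame facts: complex conjugation, `(N, d_K) = 1`, `d_K < -4`
  obtain ⟨τ, hτ⟩ := exists_algEquiv_ne_one_of_isImaginaryQuadratic K hK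
  have hND : IsCoprime ((W.conductorNorm ℤ : ℕ) : ℤ) (NumberField.discr K) :=
    KolyvaginAssembly.isCoprime_discr_of_satisfiesHeegnerHypothesis hK hHN
  have hD : NumberField.discr K < -4 := by
    have hneg : NumberField.discr K < 0 := hK.discr_neg
    have h3split : SatisfiesHeegnerHypothesis 3 K :=
      SatisfiesHeegnerHypothesis.of_dvd (dvd_conductorNorm_of_mult (W := W) hmult) hHN
    have hpd : ¬ ((3 : ℕ) : ℤ) ∣ NumberField.discr K :=
      not_dvd_discr_of_split hK Nat.prime_three (by norm_num) h3split
    have hD3 : NumberField.discr K ≠ -3 := fun h ↦ hpd (h ▸ ⟨-1, by norm_num⟩)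
    have h4 : NumberField.discr K % 4 = 0 ∨ NumberField.discr K % 4 = 1 :=
      Literature.NumberTheory.QuadraticFields.Quadratic.discr_emod_four (K := K) hK.1
    obtain ⟨r, hr⟩ := hodd
    omega
  -- Gross's one system of choices extending `d`, and Prop. 4.7 for it (from `h44`)
  have hcm : ¬ W.HasCM := not_hasCM_of_hasMultiplicativeReductionAtPrime' W hmult
  have htower : ∀ j : ℕ, W.HasSurjectiveModNGaloisRep (3 ^ j : ℕ) :=
    forall_hasSurjectiveModNGaloisRep_pow_of_multiplicative_of_surj W 3 (by norm_num) hmult hρ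
  obtain ⟨D, hDd, h47⟩ := exists_data_h47Base_of_prop44 h44 W hcm hK hD hHN (p := 3) (by norm_num) htower
    Dt β ι hk hn d
  -- the sign `ε := −w(E)`, a sign function for it, and Gross Prop. 5.3 for the data — UNCONDITIONAL
  have hε : (-W.rootNumber : ℤ) = 1 ∨ (-W.rootNumber : ℤ) = -1 := by
    rcases W.rootNumber_eq_one_or with h | h <;> simp [h]
  obtain ⟨eb, heb, hebε⟩ := Walk.exists_signFunction (-W.rootNumber) hε
  have h53D : ∀ (s s' : {m : ℕ // Squarefree m ∧ ∀ q ∈ m.primeFactors,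
        Zhang2014.IsKolyvaginPrime (W.conductorNorm ℤ) W K 3 q ∧ k ≤ Zhang2014.kolyvaginIndex W 3 q})
      (_ : s'.1 ∣ s.1) (τm : ringClassField K ι s'.1 ≃ₐ[ℚ] ringClassField K ι s'.1),
      (∀ x : ringClassField K ι s'.1, ((τm x : ringClassField K ι s'.1) : ℂ) = starRingEnd ℂ x) →
      ∃ σ' ∈ ringClassGal ι s'.1, IsOfFinAddOrder
        (pointGalHom W (ringClassField K ι s'.1) τm (D s').y -
          (-W.rootNumber) • pointGalHom W (ringClassField K ι s'.1) σ' (D s').y) := by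
    intro s s' _ τm hτm
    obtain ⟨hm0, hmN⟩ := ne_zero_and_coprime_of_isKolyvaginPrime (K := K) s'.2.1
      (fun q hq ↦ (s'.2.2 q hq).1)
    exact exists_mem_ringClassGal_isOfFinAddOrder_conj_sub_smul W hK hHN Dt ι hm0 hmN (D s') τm hτm
  -- the supply at this frame, for these data and signs
  obtain ⟨𝒯, 𝒮, Qcar, C', hS, hQcar, hdisj, hPT', hselmer, hC, hdual_q, hsel0, hdual_ℓ⟩ :=
    selmerSupplyAtThree_of_poitouTate_Gross1991 hPT hF1 W K Dt β ι hr hmult hρ hK hHN hodd hLt hβ hc3 τ hτ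
      v k hk h2 n d hn D hDd (-W.rootNumber) hε eb heb hebε
  have h49 := h49_of_selmerMembership W hK hND hD (p := 3) (by norm_num) hρ Dt β ι hτ hk 𝒯 𝒮 Qcar D eb
    (-W.rootNumber) hebε h53D n hsel0
  have hordκ := hordκ_of_admissibleData W hK hND hD (p := 3) (by norm_num) hρ Dt β ι k D
  have hdivfin := fun s ↦ divOrd_ne_top_of_levelIndex_eq_top W K
    (heegnerPointOfConductor_one_galoisConj_holds _ W K) (hGZ _ W K) hmod Dt β ι hr hK hHN hLt s (D s)
  have hfin := JET.Walk.hfin_of_kummer (K := K) W Nat.prime_three k 𝒯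
  have hκt := hκt_of_selmerMembership W hK hND hD (p := 3) (by norm_num) hρ Dt β ι hτ hk 𝒯 D eb
    (-W.rootNumber) hebε h53D hdivfin hselmer
  have key := tamagawaExponent_le_m_of_orderedFamiliesBase W K hK 3 (by decide) hρ Dt β ι τ hτ k
    (padicValNat 3 (W.tamagawaNumberAt v)) hk h2 𝒯 𝒮 hS Qcar hQcar D eb heb n hn ?_ ?_ hdisj hfin hPT'
    (fun s _ ↦ hκt s) hordκ h47 C' hC hdual_q h49 hdual_ℓ
  · rw [hDd] at key
    exact key
  · rw [hDd]; exact h1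
  · rw [hDd]; exact h3

/-- **`stub_jetchevMaxHLAtThree` VERBATIM modulo FIVE named Literature facts** {Gross 1991 Prop. 3.7 (2)
image-free, Gross–Zagier, modularity, Poitou–Tate for Selmer structures, Gross 1991 §6 ∕ [GZ86 III (3.1)]}
— McCallum 1991 Prop. 5.2 REPLACED by cell bsd-jet's kernel prime swap (`JET.Swap.levelRaising_of_literature`)
and Prop. 4.4 by `JET.prop44_of_frobeniusCongruence`; see the module docstring. CONDITIONAL, nothing
asserted about any curve; the stub is NOT discharged.
[cite: Jetchev2008, Thm. 1.4 (p. 812), Proof of Thm. 1.1 (pp. 820–824)] [cite: McCallumLMS1991, §4 Prop. 4.4,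
§5 Prop. 5.2 and proof (pp. 304–306)] [cite: GrossLMS1991, Prop. 3.7 (2), §5 Prop. 5.3, §6 Prop. 6.2 (1)]
[cite: GrossZagier1986, I (6.3), III (3.1)] [cite: MilneADT2006, Ch. I, Thm. 4.10(b)] -/
theorem jetchevMaxHLAtThree_of_swapLiterature
    -- NAMED LITERATURE FACTS (cite-only)
    (h372 : GrossLMS1991.prop37_2_frobeniusCongruence)
    (hGZ : ∀ (N : ℕ) [NeZero N] (W : WeierstrassCurve ℚ) (K : Type) [Field K] [NumberField K],
      gross_zagier N W K)
    (hmod : hasEntireLFunction_rat)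
    (hPT : ∀ (K : Type) [Field K] [NumberField K], poitouTate_selmerStructure_duality_conj K)
    (hF1 : Gross1991_heegnerPoint_sub_ratTorsion_mem_E0) :
    ∀ (W : WeierstrassCurve ℚ) [W.IsElliptic] [W.IsGloballyMinimal] [NeZero (W.conductorNorm ℤ)]
      (K : Type) [Field K] [NumberField K]
      (Dt : ModularParametrizationData W (W.conductorNorm ℤ)) (β : ℤ) (ι : K →+* ℂ),
      W.analyticRank = 1 → W.HasMultiplicativeReductionAtPrime 3 → Surj W 3 →
      IsImaginaryQuadratic K → SatisfiesHeegnerHypothesis (W.conductorNorm ℤ) K →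
      Odd (NumberField.discr K) → (W.quadraticTwist (NumberField.discr K : ℚ)).entireLFunction 1 ≠ 0 →
      (4 * (W.conductorNorm ℤ : ℤ)) ∣ β ^ 2 - NumberField.discr K → ¬ (3 : ℤ) ∣ Dt.c →
      ∀ (v : HeightOneSpectrum (𝓞 ℚ)) (s : ℕ), s ≤ padicValNat 3 (W.tamagawaNumberAt v) →
        ∀ (n : ℕ) (d : KolyvaginHeegnerData Dt β ι n), Squarefree n →
          (∀ ℓ ∈ n.primeFactors, Zhang2014.IsKolyvaginPrime (W.conductorNorm ℤ) W K 3 ℓ ∧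
            s ≤ Zhang2014.kolyvaginIndex W 3 ℓ) → PDiv d 3 s := by
  haveI : Fact (Nat.Prime 3) := ⟨Nat.prime_three⟩
  refine jetchevMaxHLAtThree_of_swap_of_perLevel' ?_
    (hlevAtThree_of_prop44_of_poitouTate_of_Gross1991 (prop44_of_frobeniusCongruence h372) hGZ hmod hPT hF1)
  intro W _ _ _ K _ _ Dt β ι hr hmult hρ hK hHN hodd hLt hβ hc3 M e n d hsq hnK hall hnd
  have hp2 : (3 : ℕ) ≠ 2 := by decide
  -- frame facts: `¬CM`, the `3`-adic tower, `d_K ∉ {−3, −4}`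
  have hcm : ¬ W.HasCM := not_hasCM_of_hasMultiplicativeReductionAtPrime' W hmult
  have htower : ∀ j : ℕ, W.HasSurjectiveModNGaloisRep (3 ^ j : ℕ) :=
    forall_hasSurjectiveModNGaloisRep_pow_of_multiplicative_of_surj W 3 (by norm_num) hmult hρ
  have hneg : NumberField.discr K < 0 := hK.discr_neg
  have h3split : SatisfiesHeegnerHypothesis 3 K :=
    SatisfiesHeegnerHypothesis.of_dvd (dvd_conductorNorm_of_mult (W := W) hmult) hHN
  have hpd : ¬ ((3 : ℕ) : ℤ) ∣ NumberField.discr K :=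
    not_dvd_discr_of_split hK Nat.prime_three (by norm_num) h3split
  have hD3 : NumberField.discr K ≠ -3 := fun h ↦ hpd (h ▸ ⟨-1, by norm_num⟩)
  have hD4 : NumberField.discr K ≠ -4 := by
    have h4 : NumberField.discr K % 4 = 0 ∨ NumberField.discr K % 4 = 1 :=
      Literature.NumberTheory.QuadraticFields.Quadratic.discr_emod_four (K := K) hK.1
    obtain ⟨r, hr⟩ := hodd
    omega
  -- `M + 1` versus `1 + M` in the admissibility clauses
  have hidx : ∀ {c : ℕ}, (∀ q ∈ c.primeFactors, Zhang2014.IsKolyvaginPrime (W.conductorNorm ℤ) W K 3 q ∧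
      1 + M ≤ Zhang2014.kolyvaginIndex W 3 q) → ∀ q ∈ c.primeFactors,
      Zhang2014.IsKolyvaginPrime (W.conductorNorm ℤ) W K 3 q ∧ M + 1 ≤ Zhang2014.kolyvaginIndex W 3 q :=
    fun h q hq ↦ ⟨(h q hq).1, by rw [Nat.add_comm]; exact (h q hq).2⟩
  -- Kolyvagin's prime swap in the kernel (cell bsd-jet), fed by the three named statements
  obtain ⟨n', d', hn', hn'K, hnd'⟩ := Swap.levelRaising_of_literature hPT hF1 h372 W hcm K hK hD3 hD4 hHN
    3 hp2 htower Dt β ι M (fun c hc hcK dc ↦ hall c dc hc (hidx hcK)) n hsq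
    (fun q hq ↦ ⟨(hnK q hq).1, by rw [Nat.add_comm]; exact (hnK q hq).2⟩) d hnd e
  exact ⟨n', d', hn', fun q hq ↦ ⟨(hn'K q hq).1, le_trans (le_max_left _ _) (hn'K q hq).2⟩, hnd'⟩

end Summit.BirchSwinnertonDyer.Rank1Residual.X11b.Three.Koly

end
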